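import Mathlib
import HarnessLib
import Summits.Ventures.LatticeQCDFlow.Scoring.SplitChain
import Summits.Ventures.LatticeQCDFlow.Scoring.ConstantKernelChain

/-!
# The split chain, continued: every state after a head is a fresh `ν κ^t` draw independent of the
# pre-head past, and the simulated chain carries a split chain (packaged statement)

HONEST FRAMING: exact (Metropolis-corrected) sampling algorithms for lattice gauge theory;
figures of merit are autocorrelation/cost numbers at stated couplings and volumes; no
continuum-physics claim.

Venture `LatticeQCDFlow` (cell pub-lqcd), topic `Scoring`; FANOUT row 8 (`s0-cpn-nemc`, GEN-15).
NEW WORK of the cell, not a published result; no definition is introduced.  Continuation of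
`Scoring/SplitChain.lean` (split kernel `κ̂` on `Ω × Bool` of a Doeblin kernel `κ(x, ·) ≥ ε ν`,
`ε < 1`; state coordinate = the `κ`-chain as a path law; next-step regeneration identity), using the
iterated tower property `chain_tower_iterate` of `Scoring/ChainPathLaw.lean`.  Printed counterpart
NAMED ONLY: the regeneration structure of the Nummelin split chain (Nummelin 1978; Athreya–Ney
1978; Meyn–Tweedie 1993 §5.1) — fixed-time form; nothing is cited as a fact.

## Content (notation of `Scoring/SplitChain.lean`; `F` a bounded measurable functional of the split
## chain's history up to time `a`, `g` bounded measurable on `Ω`)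

* **`splitChain_regeneration_iterate`** — for every `a`, `t`:
  `E[F(X̂_{≤a}) · 1{coin_{a+1} = heads} · g(X_{a+1+t})] = ε · (ν κ^t)(g) · E[F(X̂_{≤a})]`
  (the history functional `F · 1{coin_{a+1}}` is a functional of the history up to `a + 1`; the
  `t`-step tower property on the split chain; `(kop κ̂)^[t] (g ∘ fst) = ((kop κ)^[t] g) ∘ fst`; then
  the next-step regeneration identity with `κ^t g` in place of `g`);
* **`splitChain_regeneration_iterate_invariant`** — with `ν = π` invariant: `= ε · π(g) · E[F]` —
  every state after a head is `π`-distributed, independently of the pre-head past;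
* **`splitChain_coins_iid`** — the coins from time `1` on are I.I.D. Bernoulli(`ε`): the image of
  `P̂` under `x̂ ↦ (n ↦ coin_{1+n})` is Mathlib's product measure
  `Measure.infinitePi (fun _ ↦ ε δ_true + (1 − ε) δ_false)` (`Scoring/ConstantKernelChain.lean`);
* **`exists_splitChain`** — PACKAGED FOR CONSUMERS: under `κ(x, ·) ≥ ε ν` (`ε < 1`), for every
  initial law `μ₀` there is a Markov split kernel `κ̂` such that the state coordinate of the
  `κ̂`-chain from `μ₀ ⊗ δ_false` has EXACTLY the law `P_{μ₀,κ}` of the simulated chain and the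
  regeneration identities hold along it.

NOT CLAIMED: the strong Markov property at the random regeneration times / independence of the
excursions between successive heads (fixed-time identities only); any `ε` of a concrete sampler.
-/


noncomputable section

namespace Summit.Ventures.LatticeQCDFlow.Scoring

open MeasureTheory ProbabilityTheory Filter Finset Preorder Literature.Probability.MarkovChains
open scoped ENNReal

variable {Ω : Type*} [MeasurableSpace Ω]

/-! ### Regeneration: later states -/

section SplitChain

variable {κ : Kernel Ω Ω} [IsMarkovKernel κ] {ν : Measure Ω} [IsProbabilityMeasure ν] {ε : ℝ≥0∞}
  {hmin : ∀ x {B : Set Ω}, MeasurableSet B → ε * ν B ≤ κ x B}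
  (κs : Kernel (Ω × Bool) (Ω × Bool)) [IsMarkovKernel κs]
  (μs : Measure (Ω × Bool)) [IsProbabilityMeasure μs]

/-- **REGENERATION, LATER STATES.**  For every `a`, `t`, bounded measurable history functional `F`
and bounded measurable `g`:
`E[F(X̂_{≤a}) · 1{coin_{a+1} = heads} · g(X_{a+1+t})] = ε · (ν κ^t)(g) · E[F(X̂_{≤a})]`. -/
theorem splitChain_regeneration_iterate (hε : ε < 1)
    (hκs : ∀ p, κs p = (ε • ν).map (fun y : Ω => (y, true))
      + ((1 - ε) • Doeblin.residualKernel κ ν ε hmin p.1).map (fun y : Ω => (y, false)))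
    (a t : ℕ) {F : ((i : ↥(Finset.Iic a)) → Ω × Bool) → ℝ} (hF : Measurable F) {CF : ℝ}
    (hCF : ∀ h, |F h| ≤ CF) {g : Ω → ℝ} (hg : Measurable g) {Cg : ℝ} (hCg : ∀ x, |g x| ≤ Cg) :
    ∫ x, F (frestrictLe a x) * (if (x (a + 1)).2 then g (x (a + 1 + t)).1 else 0)
        ∂(Kernel.trajMeasure (X := fun _ : ℕ => Ω × Bool) μs
          (fun n : ℕ => κs.comap (fun h : (i : ↥(Finset.Iic n)) → Ω × Bool =>
            h ⟨n, Finset.mem_Iic.2 le_rfl⟩) (measurable_pi_apply _)))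
      = ε.toReal * (∫ y, (kop κ)^[t] g y ∂ν) * ∫ x, F (frestrictLe a x)
        ∂(Kernel.trajMeasure (X := fun _ : ℕ => Ω × Bool) μs
          (fun n : ℕ => κs.comap (fun h : (i : ↥(Finset.Iic n)) → Ω × Bool =>
            h ⟨n, Finset.mem_Iic.2 le_rfl⟩) (measurable_pi_apply _))) := by
  obtain ⟨hmt, hbt⟩ := iterate_kop_bounded_measurable κ hg hCg t
  -- the history functional `F(x_{≤a}) · 1{coin_{a+1}}`, a functional of the history up to `a + 1`
  have hF' : Measurable fun h : (i : ↥(Finset.Iic (a + 1))) → Ω × Bool =>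
      F (fun i : ↥(Finset.Iic a) => h ⟨i, Finset.mem_Iic.2 ((Finset.mem_Iic.1 i.2).trans
        (Nat.le_succ a))⟩) * (if (h ⟨a + 1, Finset.mem_Iic.2 le_rfl⟩).2 then (1 : ℝ) else 0) := by
    refine (hF.comp (measurable_pi_lambda _ fun i => measurable_pi_apply _)).mul ?_
    refine Measurable.ite ?_ measurable_const measurable_const
    exact (measurable_snd.comp (measurable_pi_apply _)) (measurableSet_singleton true)
  have hCF' : ∀ h : (i : ↥(Finset.Iic (a + 1))) → Ω × Bool,
      |F (fun i : ↥(Finset.Iic a) => h ⟨i, Finset.mem_Iic.2 ((Finset.mem_Iic.1 i.2).trans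
        (Nat.le_succ a))⟩) * (if (h ⟨a + 1, Finset.mem_Iic.2 le_rfl⟩).2 then (1 : ℝ) else 0)|
        ≤ |CF| := fun h => by
    rw [abs_mul]
    have h1 : |(if (h ⟨a + 1, Finset.mem_Iic.2 le_rfl⟩).2 then (1 : ℝ) else 0)| ≤ 1 := by
      split_ifs <;> simp
    calc |F _| * |(if (h ⟨a + 1, Finset.mem_Iic.2 le_rfl⟩).2 then (1 : ℝ) else 0)|
        ≤ |CF| * 1 := mul_le_mul ((hCF _).trans (le_abs_self _)) h1 (abs_nonneg _) (abs_nonneg _)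
      _ = |CF| := mul_one _
  have key := chain_tower_iterate κs μs (a + 1) hF' hCF' t (hg.comp measurable_fst)
    (Cg := Cg) (fun p => hCg p.1)
  rw [splitKernel_iterate_kop_comp_fst (κ := κ) (ν := ν) (hmin := hmin) hε hκs hg hCg t] at key
  have hlhs : ∫ x, F (frestrictLe a x) * (if (x (a + 1)).2 then g (x (a + 1 + t)).1 else 0)
        ∂(Kernel.trajMeasure (X := fun _ : ℕ => Ω × Bool) μs
          (fun n : ℕ => κs.comap (fun h : (i : ↥(Finset.Iic n)) → Ω × Bool =>
            h ⟨n, Finset.mem_Iic.2 le_rfl⟩) (measurable_pi_apply _)))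
      = ∫ x, F (fun i : ↥(Finset.Iic a) => frestrictLe (a + 1) x ⟨i, Finset.mem_Iic.2
          ((Finset.mem_Iic.1 i.2).trans (Nat.le_succ a))⟩)
          * (if (frestrictLe (a + 1) x ⟨a + 1, Finset.mem_Iic.2 le_rfl⟩).2 then (1 : ℝ) else 0)
          * (g ∘ Prod.fst) (x (a + 1 + t))
        ∂(Kernel.trajMeasure (X := fun _ : ℕ => Ω × Bool) μs
          (fun n : ℕ => κs.comap (fun h : (i : ↥(Finset.Iic n)) → Ω × Bool =>
            h ⟨n, Finset.mem_Iic.2 le_rfl⟩) (measurable_pi_apply _))) := by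
    refine integral_congr_ae (ae_of_all _ fun x => ?_)
    show F (frestrictLe a x) * (if (x (a + 1)).2 then g (x (a + 1 + t)).1 else 0)
      = F (frestrictLe a x) * (if (x (a + 1)).2 then (1 : ℝ) else 0) * g (x (a + 1 + t)).1
    split_ifs <;> simp
  have hrhs : ∫ x, F (fun i : ↥(Finset.Iic a) => frestrictLe (a + 1) x ⟨i, Finset.mem_Iic.2
          ((Finset.mem_Iic.1 i.2).trans (Nat.le_succ a))⟩)
          * (if (frestrictLe (a + 1) x ⟨a + 1, Finset.mem_Iic.2 le_rfl⟩).2 then (1 : ℝ) else 0)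
          * ((kop κ)^[t] g ∘ Prod.fst) (x (a + 1))
        ∂(Kernel.trajMeasure (X := fun _ : ℕ => Ω × Bool) μs
          (fun n : ℕ => κs.comap (fun h : (i : ↥(Finset.Iic n)) → Ω × Bool =>
            h ⟨n, Finset.mem_Iic.2 le_rfl⟩) (measurable_pi_apply _)))
      = ∫ x, F (frestrictLe a x) * (if (x (a + 1)).2 then (kop κ)^[t] g (x (a + 1)).1 else 0)
        ∂(Kernel.trajMeasure (X := fun _ : ℕ => Ω × Bool) μs
          (fun n : ℕ => κs.comap (fun h : (i : ↥(Finset.Iic n)) → Ω × Bool =>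
            h ⟨n, Finset.mem_Iic.2 le_rfl⟩) (measurable_pi_apply _))) := by
    refine integral_congr_ae (ae_of_all _ fun x => ?_)
    show F (frestrictLe a x) * (if (x (a + 1)).2 then (1 : ℝ) else 0) * (kop κ)^[t] g (x (a + 1)).1
      = F (frestrictLe a x) * (if (x (a + 1)).2 then (kop κ)^[t] g (x (a + 1)).1 else 0)
    split_ifs <;> simp
  rw [hlhs, key, hrhs]
  exact splitChain_regeneration κs μs (κ := κ) (ν := ν) (hmin := hmin) hε hκs a hF hCF hmt hbt

/-- **With `ν = π` invariant: every state after a head is `π`-distributed, independently of the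
pre-head past** — `E[F(X̂_{≤a}) 1{coin_{a+1}} g(X_{a+1+t})] = ε · π(g) · E[F(X̂_{≤a})]`. -/
theorem splitChain_regeneration_iterate_invariant {π : Measure Ω} [IsProbabilityMeasure π]
    {hminπ : ∀ x {B : Set Ω}, MeasurableSet B → ε * π B ≤ κ x B} (hπ : Kernel.Invariant κ π)
    (hε : ε < 1)
    (hκs : ∀ p, κs p = (ε • π).map (fun y : Ω => (y, true))
      + ((1 - ε) • Doeblin.residualKernel κ π ε hminπ p.1).map (fun y : Ω => (y, false)))
    (a t : ℕ) {F : ((i : ↥(Finset.Iic a)) → Ω × Bool) → ℝ} (hF : Measurable F) {CF : ℝ}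
    (hCF : ∀ h, |F h| ≤ CF) {g : Ω → ℝ} (hg : Measurable g) {Cg : ℝ} (hCg : ∀ x, |g x| ≤ Cg) :
    ∫ x, F (frestrictLe a x) * (if (x (a + 1)).2 then g (x (a + 1 + t)).1 else 0)
        ∂(Kernel.trajMeasure (X := fun _ : ℕ => Ω × Bool) μs
          (fun n : ℕ => κs.comap (fun h : (i : ↥(Finset.Iic n)) → Ω × Bool =>
            h ⟨n, Finset.mem_Iic.2 le_rfl⟩) (measurable_pi_apply _)))
      = ε.toReal * (∫ y, g y ∂π) * ∫ x, F (frestrictLe a x)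
        ∂(Kernel.trajMeasure (X := fun _ : ℕ => Ω × Bool) μs
          (fun n : ℕ => κs.comap (fun h : (i : ↥(Finset.Iic n)) → Ω × Bool =>
            h ⟨n, Finset.mem_Iic.2 le_rfl⟩) (measurable_pi_apply _))) := by
  rw [splitChain_regeneration_iterate κs μs (κ := κ) (ν := π) (hmin := hminπ) hε hκs a t hF hCF
    hg hCg, integral_iterate_kop κ hπ hg hCg t]

/-- **THE COINS ARE I.I.D. BERNOULLI(`ε`)**: the image of the split chain's law under
`x̂ ↦ (n ↦ coin_{1+n})` is the product measure `⨂_{n} (ε δ_true + (1 − ε) δ_false)` (whatever the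
initial law; the time-`0` coin is the initial one and is dropped). -/
theorem splitChain_coins_iid (hε : ε < 1)
    (hκs : ∀ p, κs p = (ε • ν).map (fun y : Ω => (y, true))
      + ((1 - ε) • Doeblin.residualKernel κ ν ε hmin p.1).map (fun y : Ω => (y, false))) :
    (Kernel.trajMeasure (X := fun _ : ℕ => Ω × Bool) μs
        (fun n : ℕ => κs.comap (fun h : (i : ↥(Finset.Iic n)) → Ω × Bool =>
          h ⟨n, Finset.mem_Iic.2 le_rfl⟩) (measurable_pi_apply _))).map
        (fun (x : ℕ → Ω × Bool) (n : ℕ) => (x (1 + n)).2)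
      = Measure.infinitePi (fun _ : ℕ => ε • Measure.dirac true + (1 - ε) • Measure.dirac false) := by
  haveI := isProbabilityMeasure_coin hε.le
  haveI : IsProbabilityMeasure (μs.map Prod.snd) :=
    Measure.isProbabilityMeasure_map measurable_snd.aemeasurable
  have hshift : Measurable (fun (c : ℕ → Bool) (n : ℕ) => c (1 + n)) :=
    measurable_pi_lambda _ fun n => measurable_pi_apply _
  have hsnd : Measurable (fun (x : ℕ → Ω × Bool) (n : ℕ) => (x n).2) :=
    measurable_pi_lambda _ fun n => measurable_snd.comp (measurable_pi_apply n)
  have hcomp : (fun (x : ℕ → Ω × Bool) (n : ℕ) => (x (1 + n)).2)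
      = (fun (c : ℕ → Bool) (n : ℕ) => c (1 + n)) ∘ (fun (x : ℕ → Ω × Bool) (n : ℕ) => (x n).2) :=
    rfl
  have h1 : (Kernel.trajMeasure (X := fun _ : ℕ => Bool) (μs.map Prod.snd)
      (fun n : ℕ => (Kernel.const Bool (ε • Measure.dirac true
          + (1 - ε) • Measure.dirac false)).comap
        (fun h : (i : ↥(Finset.Iic n)) → Bool => h ⟨n, Finset.mem_Iic.2 le_rfl⟩)
        (measurable_pi_apply _))).map (fun c : ℕ → Bool => c 1)
      = ε • Measure.dirac true + (1 - ε) • Measure.dirac false :=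
    chain_const_map_eval_succ _ _ 0
  haveI : IsProbabilityMeasure ((Kernel.trajMeasure (X := fun _ : ℕ => Bool) (μs.map Prod.snd)
      (fun n : ℕ => (Kernel.const Bool (ε • Measure.dirac true
          + (1 - ε) • Measure.dirac false)).comap
        (fun h : (i : ↥(Finset.Iic n)) → Bool => h ⟨n, Finset.mem_Iic.2 le_rfl⟩)
        (measurable_pi_apply _))).map (fun c : ℕ → Bool => c 1)) := by
    rw [h1]; infer_instance
  rw [hcomp, ← Measure.map_map hshift hsnd, splitChain_map_snd κs μs (κ := κ) (ν := ν) (hmin := hmin)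
    hε hκs, chain_map_shift _ _ 1, h1, chain_const_iid]

end SplitChain

/-! ### Packaged: the simulated chain carries a split chain -/

section Packaged

variable {κ : Kernel Ω Ω} [IsMarkovKernel κ] {ν : Measure Ω} [IsProbabilityMeasure ν] {ε : ℝ≥0∞}
  {hmin : ∀ x {B : Set Ω}, MeasurableSet B → ε * ν B ≤ κ x B}

/-- **THE SIMULATED CHAIN CARRIES A SPLIT CHAIN.**  Under `κ(x, ·) ≥ ε ν` (`ε < 1`), for every
initial law `μ₀` there is a Markov kernel `κ̂` on `Ω × Bool` — a split kernel of `κ` — such that the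
state coordinate of the `κ̂`-chain started from `μ₀ ⊗ δ_false` has EXACTLY the law `P_{μ₀,κ}` of the
simulated chain, while along that chain every coin is heads with probability `ε` given the past and
every head regenerates the state from `ν` (`splitChain_regeneration`, `…_iterate`). -/
theorem exists_splitChain (hε : ε < 1) (μ₀ : Measure Ω) [IsProbabilityMeasure μ₀] :
    ∃ κs : Kernel (Ω × Bool) (Ω × Bool), ∃ _ : IsMarkovKernel κs,
      (∀ p, κs p = (ε • ν).map (fun y : Ω => (y, true))
        + ((1 - ε) • Doeblin.residualKernel κ ν ε hmin p.1).map (fun y : Ω => (y, false))) ∧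
      (Kernel.trajMeasure (X := fun _ : ℕ => Ω × Bool) (μ₀.map (fun y : Ω => (y, false)))
          (fun n : ℕ => κs.comap (fun h : (i : ↥(Finset.Iic n)) → Ω × Bool =>
            h ⟨n, Finset.mem_Iic.2 le_rfl⟩) (measurable_pi_apply _))).map
          (fun (x : ℕ → Ω × Bool) (n : ℕ) => (x n).1)
        = Kernel.trajMeasure (X := fun _ : ℕ => Ω) μ₀
          (fun n : ℕ => κ.comap (fun h : (i : ↥(Finset.Iic n)) → Ω => h ⟨n, Finset.mem_Iic.2 le_rfl⟩)
            (measurable_pi_apply _)) ∧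
      ∀ (a t : ℕ) {F : ((i : ↥(Finset.Iic a)) → Ω × Bool) → ℝ}, Measurable F → ∀ {CF : ℝ},
        (∀ h, |F h| ≤ CF) → ∀ {g : Ω → ℝ}, Measurable g → ∀ {Cg : ℝ}, (∀ x, |g x| ≤ Cg) →
        ∫ x, F (frestrictLe a x) * (if (x (a + 1)).2 then g (x (a + 1 + t)).1 else 0)
            ∂(Kernel.trajMeasure (X := fun _ : ℕ => Ω × Bool) (μ₀.map (fun y : Ω => (y, false)))
              (fun n : ℕ => κs.comap (fun h : (i : ↥(Finset.Iic n)) → Ω × Bool =>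
                h ⟨n, Finset.mem_Iic.2 le_rfl⟩) (measurable_pi_apply _)))
          = ε.toReal * (∫ y, (kop κ)^[t] g y ∂ν) * ∫ x, F (frestrictLe a x)
            ∂(Kernel.trajMeasure (X := fun _ : ℕ => Ω × Bool) (μ₀.map (fun y : Ω => (y, false)))
              (fun n : ℕ => κs.comap (fun h : (i : ↥(Finset.Iic n)) → Ω × Bool =>
                h ⟨n, Finset.mem_Iic.2 le_rfl⟩) (measurable_pi_apply _))) := by
  obtain ⟨κs, hM, hκs⟩ := exists_splitKernel (κ := κ) (ν := ν) (hmin := hmin) hε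
  haveI : IsProbabilityMeasure (μ₀.map (fun y : Ω => (y, false))) :=
    Measure.isProbabilityMeasure_map (measurable_tagCoin false).aemeasurable
  refine ⟨κs, hM, hκs, ?_, fun a t F hF CF hCF g hg Cg hCg => ?_⟩
  · rw [splitChain_map_fst κs _ (κ := κ) (ν := ν) (hmin := hmin) hε hκs,
      Measure.map_map measurable_fst (measurable_tagCoin false)]
    have : Prod.fst ∘ (fun y : Ω => (y, false)) = id := rfl
    rw [this, Measure.map_id]
  · exact splitChain_regeneration_iterate κs _ (κ := κ) (ν := ν) (hmin := hmin) hε hκs a t hF hCF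
      hg hCg

end Packaged

end Summit.Ventures.LatticeQCDFlow.Scoring

end
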